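import Literature.NumberTheory.GaloisRepresentations.LubinTateColemanCoordGaloisTwo
import HarnessLib

/-!
# The twists `ρ_v` form a COCYCLE: `ρ_{vv'} = ρ_v · (ρ_{v'} ∘ [v]_f)`, so the operators `r ↦ v·ρ_v·(r ∘ [v]_f)` compose multiplicatively —
# the `𝒪_F^×`-action on the whole coordinate module `𝒪_F⟦Y⟧` at `q = 2` (de Shalit I §3.4 Lemma (ii), §3.7)

De Shalit, *Iwasawa theory of elliptic curves with complex multiplication* (1987), Ch. I §3.4 Lemma (ii): `μ_{σβ} = σμ_β` — Coleman's map is a map of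
`𝒢`-MODULES.  In the tree's series currency at `q = 2` (`π = 2u`, `f = πX + X²`) the action of `v ∈ 𝒪_F^× ≅ Gal(K_π^∞/F)` on the coordinates is
`r_{σ_vβ} = v·ρ_v·(r_β ∘ [v]_f)` (`unitCoordTwo_unitAct`, `LubinTateColemanCoordGaloisTwo`), with the twist `ρ_v` defined by
`(1 + tX)(ρ_v ∘ f) = 1 + t[v]_f` (`2 = πt`).  On the IMAGE of `𝒰` these operators compose like the group because they come from a group
action; this file proves that they do so on ALL of `𝒪_F⟦Y⟧`:

* ★★ `evenPartTwo_unitTwistSerTwo_mul` — the cocycle identity **`ρ_{vv'} = ρ_v · (ρ_{v'} ∘ [v]_f)`** (both sides solve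
  `(1 + tX)(R ∘ f) = 1 + t[vv']_f`: `[v'] ∘ [v] = [vv']`, `f ∘ [v] = [v] ∘ f`, uniqueness `eq_of_one_add_mul_subst_eq_two`);
* ★★ `unitTwist_comp` — **`𝐋_v(𝐋_{v'} r) = 𝐋_{vv'} r`** for `𝐋_v r := v·ρ_v·(r ∘ [v]_f)`; `unitTwist_comm` — the `𝐋_v` commute; `unitTwist_one` —
  `𝐋_1 = id`.  Hence `v ↦ 𝐋_v` is an action of the abelian group `𝒪_F^×` on `𝒪_F⟦Y⟧` by ring-linear operators, the `Λ(𝒪_F^×)`-structure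
  extending `Λ(Γ') = 𝒪_F⟦T⟧` (`T = 𝐋_γ − 1`, `LubinTateColemanCoordIwasawaActionTwo`) by `Δ = {±1}` (`LubinTateColemanCoordDeltaTwo`).

Everything PROVED (0 sorry, no named facts, no new definitions).

## References

* E. de Shalit, *Iwasawa theory of elliptic curves with complex multiplication* (1987), Ch. I §3.4 Lemma (ii), §3.7. [deShalit1987]
* J. Lubin, J. Tate, *Formal complex multiplication in local fields*, Ann. of Math. 81 (1965), §1 Thm. 1 (9). [LubinTate1965]
-/

noncomputable section

open scoped PowerSeries.WithPiTopology

namespace Literature.NumberTheory.GaloisRepresentations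

section TwistCocycleTwo

open GaloisRepresentations.IsNonarchimedeanLocalField LubinTate ValuativeRel

variable {F : Type} [Field F] [ValuativeRel F] [TopologicalSpace F] [IsNonarchimedeanLocalField F]

attribute [local instance] ltNormUniformSpace ltNormIsUniformAddGroup rk1 nF nE fintypeResidueField

variable {π : 𝒪[F]} (hπ : (valuation F).IsUniformizer (π : F)) (hq : residueFieldCard F = 2)

/-- `[v]_f` is substitutable. [folklore] -/
private theorem hasSubst_homc (v : LTCoeff F) :
    PowerSeries.HasSubst (hom (isLTRing_LTCoeff hπ) (isLTSeries_LTCoeff π) (isLTSeries_LTCoeff π) v) :=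
  PowerSeries.HasSubst.of_constantCoeff_zero' (constantCoeff_hom _ _ _ v)

/-- `f` is substitutable. [folklore] -/
private theorem hasSubst_ltSerc : PowerSeries.HasSubst (ltSer F π) :=
  PowerSeries.HasSubst.of_constantCoeff_zero' (isLTSeries_ltSer π).constantCoeff_eq_zero

/-- `(1 + tX) ∘ [v] = 1 + t[v]`. [cite: deShalit1987, Ch. I §3.4 Lemma (ii)] -/
theorem subst_hom_one_add_C_mul_X (t v : LTCoeff F) :
    PowerSeries.subst (hom (isLTRing_LTCoeff hπ) (isLTSeries_LTCoeff π) (isLTSeries_LTCoeff π) v) (1 + PowerSeries.C t * PowerSeries.X) =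
      1 + PowerSeries.C t * hom (isLTRing_LTCoeff hπ) (isLTSeries_LTCoeff π) (isLTSeries_LTCoeff π) v := by
  rw [← PowerSeries.coe_substAlgHom (hasSubst_homc hπ v), map_add, map_one, map_mul, PowerSeries.coe_substAlgHom, PowerSeries.subst_C,
    PowerSeries.subst_X (hasSubst_homc hπ v)]
  rfl

/-- `[v'] ∘ [v] = [vv']` as a substitution: `subst [v] [v'] = [v'v]`. [cite: LubinTate1965, §1 Thm. 1 (9)] -/
theorem subst_hom_hom (v v' : LTCoeff F) :
    PowerSeries.subst (hom (isLTRing_LTCoeff hπ) (isLTSeries_LTCoeff π) (isLTSeries_LTCoeff π) v)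
        (hom (isLTRing_LTCoeff hπ) (isLTSeries_LTCoeff π) (isLTSeries_LTCoeff π) v') =
      hom (isLTRing_LTCoeff hπ) (isLTSeries_LTCoeff π) (isLTSeries_LTCoeff π) (v' * v) :=
  hom_comp_hom _ _ _ _ v' v

/-! ### The cocycle identity -/

/-- ★★ **The cocycle identity `ρ_{vv'} = ρ_v · (ρ_{v'} ∘ [v]_f)`** (`2 = πt`): both sides `R` satisfy `(1 + tX)(R ∘ f) = 1 + t[vv']_f`.
[cite: deShalit1987, Ch. I §3.4 Lemma (ii)] -/
theorem evenPartTwo_unitTwistSerTwo_mul {t : LTCoeff F} (ht : (2 : LTCoeff F) = LTCoeff.of F π * t) (v v' : 𝒪[F]ˣ) :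
    evenPartTwo hπ hq (unitTwistSerTwo hπ t (v * v')) = evenPartTwo hπ hq (unitTwistSerTwo hπ t v) *
      PowerSeries.subst (hom (isLTRing_LTCoeff hπ) (isLTSeries_LTCoeff π) (isLTSeries_LTCoeff π) (LTCoeff.of F (v : 𝒪[F])))
        (evenPartTwo hπ hq (unitTwistSerTwo hπ t v')) := by
  set H := hom (isLTRing_LTCoeff hπ) (isLTSeries_LTCoeff π) (isLTSeries_LTCoeff π) (LTCoeff.of F (v : 𝒪[F])) with hH
  set ρ := evenPartTwo hπ hq (unitTwistSerTwo hπ t v) with hρ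
  set ρ' := evenPartTwo hπ hq (unitTwistSerTwo hπ t v') with hρ'
  refine (eq_of_one_add_mul_subst_eq_two hπ hq t ?_).symm
  -- `(1 + tX)·((ρ · (ρ' ∘ [v])) ∘ f) = (1 + t[v]) · ((ρ' ∘ f) ∘ [v]) = ((1 + tX)(ρ' ∘ f)) ∘ [v] = (1 + t[v']) ∘ [v] = 1 + t[vv']`
  have h1 := one_add_mul_subst_evenPartTwo_unitTwistSerTwo hπ hq ht v
  have h2 := one_add_mul_subst_evenPartTwo_unitTwistSerTwo hπ hq ht v'
  have h3 := one_add_mul_subst_evenPartTwo_unitTwistSerTwo hπ hq ht (v * v')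
  rw [← hρ, ← hH] at h1
  rw [← hρ'] at h2
  rw [h3, PowerSeries.subst_mul hasSubst_ltSerc, ← mul_assoc, h1, hH, ← subst_hom_subst_ltSer hπ, ← subst_hom_one_add_C_mul_X hπ,
    ← PowerSeries.subst_mul (hasSubst_homc hπ _), h2, ← PowerSeries.coe_substAlgHom (hasSubst_homc hπ _), map_add, map_one, map_mul,
    PowerSeries.coe_substAlgHom, PowerSeries.subst_C, subst_hom_hom hπ, Units.val_mul, map_mul, mul_comm (LTCoeff.of F (v' : 𝒪[F]))]
  rfl

/-! ### The operators `𝐋_v r = v·ρ_v·(r ∘ [v])` compose like the group -/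

/-- ★★ **`𝐋_v(𝐋_{v'} r) = 𝐋_{vv'} r`** for `𝐋_v r := v·ρ_v·(r ∘ [v]_f)` (`π = 2u`, `t = u⁻¹`): the unit action on the coordinate module is an
action of `𝒪_F^×` on ALL of `𝒪_F⟦Y⟧`. [cite: deShalit1987, Ch. I §3.4 Lemma (ii), §3.7] -/
theorem unitTwist_comp (u : (LTCoeff F)ˣ) (hu : LTCoeff.of F π = residueFieldCard F * u) (v v' : 𝒪[F]ˣ) (r : PowerSeries (LTCoeff F)) :
    PowerSeries.C (LTCoeff.of F (v : 𝒪[F])) * evenPartTwo hπ hq (unitTwistSerTwo hπ (↑u⁻¹ : LTCoeff F) v) *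
        PowerSeries.subst (hom (isLTRing_LTCoeff hπ) (isLTSeries_LTCoeff π) (isLTSeries_LTCoeff π) (LTCoeff.of F (v : 𝒪[F])))
          (PowerSeries.C (LTCoeff.of F (v' : 𝒪[F])) * evenPartTwo hπ hq (unitTwistSerTwo hπ (↑u⁻¹ : LTCoeff F) v') *
            PowerSeries.subst (hom (isLTRing_LTCoeff hπ) (isLTSeries_LTCoeff π) (isLTSeries_LTCoeff π) (LTCoeff.of F (v' : 𝒪[F]))) r) =
      PowerSeries.C (LTCoeff.of F ((v * v' : 𝒪[F]ˣ) : 𝒪[F])) * evenPartTwo hπ hq (unitTwistSerTwo hπ (↑u⁻¹ : LTCoeff F) (v * v')) *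
        PowerSeries.subst (hom (isLTRing_LTCoeff hπ) (isLTSeries_LTCoeff π) (isLTSeries_LTCoeff π) (LTCoeff.of F ((v * v' : 𝒪[F]ˣ) : 𝒪[F]))) r := by
  have ht := two_eq_of_mul_inv hq u hu
  have hs := hasSubst_homc hπ (LTCoeff.of F (v : 𝒪[F]))
  have hs' := hasSubst_homc hπ (LTCoeff.of F (v' : 𝒪[F]))
  rw [evenPartTwo_unitTwistSerTwo_mul hπ hq ht v v', ← PowerSeries.coe_substAlgHom hs, map_mul, map_mul, PowerSeries.coe_substAlgHom,
    PowerSeries.subst_C, PowerSeries.subst_comp_subst_apply hs' hs, subst_hom_hom hπ, Units.val_mul, map_mul, map_mul,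
    mul_comm (LTCoeff.of F (v' : 𝒪[F])) (LTCoeff.of F (v : 𝒪[F]))]
  change _ = _ * PowerSeries.subst (hom (isLTRing_LTCoeff hπ) (isLTSeries_LTCoeff π) (isLTSeries_LTCoeff π)
    (LTCoeff.of F (v : 𝒪[F]) * LTCoeff.of F (v' : 𝒪[F]))) r
  rw [mul_comm (LTCoeff.of F (v : 𝒪[F])) (LTCoeff.of F (v' : 𝒪[F]))]
  change PowerSeries.C (LTCoeff.of F (v : 𝒪[F])) * evenPartTwo hπ hq (unitTwistSerTwo hπ (↑u⁻¹ : LTCoeff F) v) *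
      (PowerSeries.C (LTCoeff.of F (v' : 𝒪[F])) * _ * _) = _
  ring

/-- ★ **The twists commute**: `𝐋_v(𝐋_{v'} r) = 𝐋_{v'}(𝐋_v r)` (`𝒪_F^×` is abelian). [cite: deShalit1987, Ch. I §3.4 Lemma (ii), §3.7] -/
theorem unitTwist_comm (u : (LTCoeff F)ˣ) (hu : LTCoeff.of F π = residueFieldCard F * u) (v v' : 𝒪[F]ˣ) (r : PowerSeries (LTCoeff F)) :
    PowerSeries.C (LTCoeff.of F (v : 𝒪[F])) * evenPartTwo hπ hq (unitTwistSerTwo hπ (↑u⁻¹ : LTCoeff F) v) *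
        PowerSeries.subst (hom (isLTRing_LTCoeff hπ) (isLTSeries_LTCoeff π) (isLTSeries_LTCoeff π) (LTCoeff.of F (v : 𝒪[F])))
          (PowerSeries.C (LTCoeff.of F (v' : 𝒪[F])) * evenPartTwo hπ hq (unitTwistSerTwo hπ (↑u⁻¹ : LTCoeff F) v') *
            PowerSeries.subst (hom (isLTRing_LTCoeff hπ) (isLTSeries_LTCoeff π) (isLTSeries_LTCoeff π) (LTCoeff.of F (v' : 𝒪[F]))) r) =
      PowerSeries.C (LTCoeff.of F (v' : 𝒪[F])) * evenPartTwo hπ hq (unitTwistSerTwo hπ (↑u⁻¹ : LTCoeff F) v') *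
        PowerSeries.subst (hom (isLTRing_LTCoeff hπ) (isLTSeries_LTCoeff π) (isLTSeries_LTCoeff π) (LTCoeff.of F (v' : 𝒪[F])))
          (PowerSeries.C (LTCoeff.of F (v : 𝒪[F])) * evenPartTwo hπ hq (unitTwistSerTwo hπ (↑u⁻¹ : LTCoeff F) v) *
            PowerSeries.subst (hom (isLTRing_LTCoeff hπ) (isLTSeries_LTCoeff π) (isLTSeries_LTCoeff π) (LTCoeff.of F (v : 𝒪[F]))) r) := by
  rw [unitTwist_comp hπ hq u hu, unitTwist_comp hπ hq u hu, mul_comm v v']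

/-- `𝐋_1 r = r` (`ρ_1 = 1`, `[1]_f = X`). [cite: deShalit1987, Ch. I §3.4 Lemma (ii)] -/
theorem unitTwist_one (u : (LTCoeff F)ˣ) (hu : LTCoeff.of F π = residueFieldCard F * u) (r : PowerSeries (LTCoeff F)) :
    PowerSeries.C (LTCoeff.of F ((1 : 𝒪[F]ˣ) : 𝒪[F])) * evenPartTwo hπ hq (unitTwistSerTwo hπ (↑u⁻¹ : LTCoeff F) 1) *
        PowerSeries.subst (hom (isLTRing_LTCoeff hπ) (isLTSeries_LTCoeff π) (isLTSeries_LTCoeff π) (LTCoeff.of F ((1 : 𝒪[F]ˣ) : 𝒪[F]))) r = r := by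
  have ht := two_eq_of_mul_inv hq u hu
  have hX : hom (isLTRing_LTCoeff hπ) (isLTSeries_LTCoeff π) (isLTSeries_LTCoeff π) (LTCoeff.of F ((1 : 𝒪[F]ˣ) : 𝒪[F])) = PowerSeries.X := by
    rw [Units.val_one, map_one]; exact hom_one _ _
  -- `ρ_1 = 1`: `(1 + tX)(ρ_1 ∘ f) = 1 + t[1] = 1 + tX = (1 + tX)(1 ∘ f)`
  have hρ : evenPartTwo hπ hq (unitTwistSerTwo hπ (↑u⁻¹ : LTCoeff F) 1) = 1 := by
    refine eq_of_one_add_mul_subst_eq_two hπ hq (↑u⁻¹ : LTCoeff F) ?_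
    rw [one_add_mul_subst_evenPartTwo_unitTwistSerTwo hπ hq ht 1, hX, ← PowerSeries.coe_substAlgHom hasSubst_ltSerc, map_one, mul_one]
  rw [hρ, hX, Units.val_one, map_one, map_one, one_mul, one_mul, ← PowerSeries.map_algebraMap_eq_subst_X r, Algebra.algebraMap_self,
    PowerSeries.map_id]
  rfl

end TwistCocycleTwo

end Literature.NumberTheory.GaloisRepresentations
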